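import Summits.HodgeConjecture.HodgeConjecture.Theses.GenericDivisibility
import Summits.HodgeConjecture.HodgeConjecture.Theorems.GenericDivisibilityHodgeClassesGenericallyDivisibleFinite
import Literature.AlgebraicGeometry.HodgeTheory.SmallChowGroupsHodgeConjectureProofs
import Literature.AlgebraicGeometry.HodgeTheory.ComplexOrientationDegreeFormulaHolds
import Literature.AlgebraicGeometry.Resolution.ProjectiveResolutionProofs
import Literature.AlgebraicGeometry.HodgeTheory.ZariskiOpenBettiFinitenessProofs
import HarnessLib

/-!
# Route GenericDivisibility — crux C2 `GenericDivisibilityBounded` (stmt-HodgeConjecture-18467):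
# the sector of `2p`-folds with `CH₀ ⊗ ℚ` of rank `≤ 1` (Bloch–Srinivas), Hodge-free and unconditional

Line `finite-level-bootstrap`, lead c3 (cycle 5). The crux C2 ("an integral middle class divisible by
every `m` on non-empty Zariski opens has complexification of coniveau `≥ 1`") and the heart of the line
("some prime has a clean finite level") are OPEN for `p ≥ 2` in general (crux workfiles `HEART-c1.md`,
`HEART-c2.md`). The refuters' briefings (ATTACK.md, Disproof.lean §1) and Colliot-Thélène–Voisin 2012,
Prop. 3.3 (i) locate the whole content of C2 on varieties with LARGE `CH₀` (the `H^{2p,0} ≠ 0` arena):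
if `CH₀(X)` is small, every middle class dies at the generic point and C2 is empty of content. This file
makes the first `p ≥ 2` sector of the crux a THEOREM of the tree, with no Hodge theory and no
Bloch–Kato / Colliot-Thélène–Voisin input:

* `genericDivisibilityBounded_corrAct_primeCycle_eq_zero_of_height_snd_le` — the vanishing case of the
  action of a prime correspondence `[V]^*`, `V = closure {z} ⊆ X ⊗ X`, on ALL classes of degree
  `k > 2 dim pr₂(z)` (the tree's `corrAct_primeCycle_eq_zero_of_height_snd_lt` asked the class to be
  of Hodge type `(p,p)`; here `H^k(X̃'(ℂ); ℂ) = 0` for `k > 2 dim X̃'` does the job);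
* `genericDivisibilityBounded_exists_closed_forall_restrictCompl_eq_zero_of_chowRankLEOneUpTo_zero` —
  **Bloch–Srinivas**: on a smooth projective complex `n`-fold `X` with `CH₀(X) ⊗ ℚ` of rank `≤ 1`
  (`Motives.ChowRankLEOneUpTo X 0`) there is ONE Zariski-closed `T` of codimension `≥ 1` such that EVERY
  class of EVERY positive degree dies on `(X ∖ T)(ℂ)` with `ℂ`-coefficients: `m[Δ_X] ∼ Z₀ + Z'` with
  `Z₀ ⊆ W'₀ × {points}` and `Z' ⊆ T × X` (the tree's PROVED generalised decomposition of the diagonal,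
  `ParanjapeLaterveer_generalisedDecompositionOfTheDiagonal_holds`, case `k₀ = 0`), `[Δ_X]^* = Id`,
  `[Z₀]^* = 0` in positive degree, `[Z']^*α` vanishes off `T`, and `m` is invertible in `ℂ` — run through
  the tree's UNCONDITIONAL Gysin formalism of the complex orientations
  (`exists_gysinFormalism_isGysinHodgeCompatible_complexOrientation_holds`) and projective Hironaka
  (`Hironaka1964_projective_holds`); hence `supportedClasses X k 1 = ⊤` for `k ≥ 1`
  (`…_supportedClasses_one_eq_top_…`);
* `genericDivisibilityBounded_exists_closed_forall_nsmul_restrict_eq_zero_of_chowRankLEOneUpTo_zero` —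
  the INTEGRAL shadow: every `z ∈ H^k(X(ℂ); ℤ)`, `k ≥ 1`, is killed by some `N ≥ 1` on `(X ∖ T)(ℂ)`
  (Dimca finiteness of the Zariski opens, PROVED in the tree, and universal coefficients): the integral
  generic image `E = im(H^{2p}(X;ℤ) → H^{2p}(ℂ(X);ℤ))` is torsion;
* `genericDivisibilityBounded_at_of_chowRankLEOneUpTo_zero` — **C2 at every smooth projective `2p`-fold
  (`p ≥ 1`) with `CH₀ ⊗ ℚ` of rank `≤ 1`** (rationally connected, Fano, cubic fourfolds, …), in the
  crux's own shape, and `genericDivisibilityBounded_levelClean_of_chowRankLEOneUpTo_zero` — **the HEART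
  of the line at such `X`, at EVERY prime and EVERY level** (`w = 0` works);
* the same with the Chow hypothesis on the Chow GROUP `CH₀(X)` (`…_of_chowGroup_zero`) and in the
  `L`-quantified form of Vial 2013 / the C1 companion file `…SmallChow` (`…_of_chowGroups_rank_le_one`).

So a counterexample to C2, or an `X` where the line's heart fails, has `CH₀(X) ⊗ ℚ` of rank `≥ 2`
(by Bloch–Srinivas–Roitman folklore, as soon as `H^{k,0}(X) ≠ 0` for some `k > 0`; conversely Bloch's
conjecture), in Lean and not only on paper.

References: S. Bloch, V. Srinivas, Amer. J. Math. 105 (1983), Thm. 1 and its proof [BlochSrinivas1983];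
C. Voisin, Hodge Theory and Complex Algebraic Geometry II, Thm. 10.19, Cor. 10.21, Thm. 10.29, proof of
Thm. 10.17 (10.7)–(10.9) [VoisinHodgeII2003]; J.-L. Colliot-Thélène, C. Voisin, Duke Math. J. 161 (2012),
Prop. 3.3 (i) [ColliotTheleneVoisin2012]; A. Hatcher, Algebraic Topology, Thm. 3.2 [HatcherAT2002];
A. Dimca, Singularities and Topology of Hypersurfaces, Ch. 1 Cor. (6.10) [Dimca1992].
-/

-- `Summit.HodgeConjecture.HodgeConjecture.Theorems` is the mandated namespace (single-problem summit:
-- Problem = Summit), which `linter.dupNamespace` flags on every declaration; the lakefile turns the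
-- linter off tree-wide (weak option), restated here so stand-alone elaboration is warning-free too.
set_option linter.dupNamespace false

noncomputable section

open CategoryTheory CategoryTheory.Limits AlgebraicGeometry MonoidalCategory CartesianMonoidalCategory

namespace Summit.HodgeConjecture.HodgeConjecture.Theorems

open Literature.AlgebraicGeometry.Motives Literature.AlgebraicGeometry.HodgeTheory
  Literature.AlgebraicGeometry
open Literature.AlgebraicTopology.SingularHomology
open Summit.HodgeConjecture.HodgeConjecture.Theses.GenericDivisibility

/-! ### The vanishing case of `[V]^*` on all classes of large degree -/

/-- **(Vanishing case, Hodge-free.)** If `V = closure {z} ⊆ X ⊗ X` is `n`-dimensional with `pr₂(z)`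
of dimension `≤ d₀` and `k > 2 d₀`, then `[V]^*α = 0` for EVERY class `α ∈ Hᵏ(X(ℂ); ℂ)`: with
`j̃ : X̃' → closure {pr₂ z} ⊆ X` a projective resolution (`hH`) and `[Ṽ]` the lift of `[V]` along
`X ◁ j̃`, `[V]^*α = [Ṽ]^*(j̃^*α)` (Voisin II (10.9)), and `j̃^*α ∈ Hᵏ(X̃'(ℂ); ℂ) = 0` because
`k > 2 dim X̃'` (`subsingleton_complexBetti`, Hatcher Thm. 3.26 (c)). The tree's
`GysinFormalism.corrAct_primeCycle_eq_zero_of_height_snd_lt` is the same computation for `(p,p)`-classes.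
[cite: VoisinHodgeII2003, proof of Thm. 10.17 (10.9)] [cite: HatcherAT2002, §3.3 Thm. 3.26(c)] -/
theorem genericDivisibilityBounded_corrAct_primeCycle_eq_zero_of_height_snd_le (G : GysinFormalism)
    (hH : Resolution.Hironaka1964_projective.{0}) {n : ℕ} {X : SchemeOver ℂ}
    (hX : IsSmoothProjective n X) (z : ↥(X ⊗ X).left)
    (hz : primeCycle z ∈ cyclesOfDim (X ⊗ X).left n) (hzn : Order.height z = n) {d₀ k : ℕ}
    (hd₀ : Order.height ((snd X X).left.base z) ≤ (d₀ : ℕ∞)) (hlt : 2 * d₀ < k)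
    (α : complexBetti X k) :
    G.corrAct hX hX k ⟨primeCycle z, hz⟩ α = 0 := by
  classical
  set x' := (snd X X).left.base z with hx'
  set X₀ := ClosedSubvariety.ofPoint X.left x' with hX₀
  obtain ⟨d', X₁, π, hX₁, hπ, hdim⟩ := exists_resolution_ofPoint hH hX x'
  -- `d' = dim closure {x'} ≤ d₀`, so `2 d' < k`
  have hd' : 2 * d' < k := by
    rw [hdim] at hd₀
    have h : d' ≤ d₀ := by exact_mod_cast hd₀
    omega
  have hXX₁ := IsSmoothProjective.tensor_holds hX hX₁
  haveI := noetherianSpace_of_isSmoothProjective hXX₁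
  set j : X₁ ⟶ X := π ≫ X₀.ιOver with hj
  -- lift `[closure z]` along `X ◁ j`
  obtain ⟨z₁, hz₁, hmap⟩ := primeCycle_lift_of_isBirational_holds hX hX hX₁ X₀ j π.left rfl hπ z
    (by rw [ClosedSubvariety.genericPoint_ofPoint])
  have hz₁n : primeCycle z₁ ∈ cyclesOfDim (X ⊗ X₁).left n :=
    primeCycle_mem_cyclesOfDim (by rw [hz₁, hzn])
  have hpush : cyclesOfDimMap n (X ◁ j).left ⟨primeCycle z₁, hz₁n⟩ = ⟨primeCycle z, hz⟩ :=
    Subtype.ext hmap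
  -- (10.9): `[V]^*α = [Ṽ]^*(j^*α)`
  rw [← hpush, G.corrAct_eq_corrActGen,
    G.corrActGen_cyclesOfDimMap_whiskerLeft hX hX hX₁ j rfl (show n + d' = n + d' from rfl) rfl
      (show k + 2 * d' = k + 2 * d' from rfl) ⟨primeCycle z₁, hz₁n⟩,
    LinearMap.comp_apply]
  -- `j^*α ∈ Hᵏ(X₁(ℂ); ℂ) = 0` as `k > 2 dim X₁`
  haveI := subsingleton_complexBetti hX₁ (k := k) hd'
  rw [show (complexBetti.map j k).hom α = 0 from Subsingleton.elim _ _, map_zero]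

/-! ### Bloch–Srinivas: small `CH₀` kills every positive-degree class off one divisor -/

/-- **Bloch–Srinivas (complex coefficients).** Let `X` be a smooth projective complex `n`-fold whose
`0`-cycles have `ℚ`-rank `≤ 1` (`ChowRankLEOneUpTo X 0`). Then there is ONE Zariski-closed `T ⊆ X` all
of whose points have codimension `≥ 1` such that every class of every degree `k ≥ 1` restricts to `0` on
`(X ∖ T)(ℂ)`. Proof: the generalised decomposition of the diagonal with `k₀ = 0` (PROVED in the tree),
`m[Δ_X] ∼ Z₀ + Z'`, `m > 0`, `Z₀` supported in `W'₀ × W₀` with `W₀` a closed set of closed points,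
`Z'` supported over `T`; acting by `[·]^*` through any Gysin formalism (one exists unconditionally:
the complex orientations), `m α = [Z₀]^*α + [Z']^*α` (`[Δ_X]^* = Id`, Lemma 9.18), `[Z₀]^*α = 0` for
`k > 0 = 2 dim W₀` (vanishing case, prime cycle by prime cycle), `[Z']^*α` vanishes off `T` ((10.8)),
and `m` is invertible in `ℂ`. [cite: BlochSrinivas1983, Thm. 1 and its proof]
[cite: VoisinHodgeII2003, Thm. 10.19, Cor. 10.21, Thm. 10.29 and proof of Thm. 10.17 (10.7)-(10.9)] -/
theorem genericDivisibilityBounded_exists_closed_forall_restrictCompl_eq_zero_of_chowRankLEOneUpTo_zero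
    {n : ℕ} {X : SchemeOver ℂ} (hX : IsSmoothProjective n X) (h0 : ChowRankLEOneUpTo X 0) :
    ∃ T : Set X.left, IsClosed T ∧ (∀ t ∈ T, (1 : ℕ∞) ≤ Order.coheight t) ∧
      ∀ k : ℕ, 1 ≤ k → ∀ α : complexBetti X k, complexBetti.restrictCompl X T k α = 0 := by
  classical
  obtain ⟨G, -⟩ := exists_gysinFormalism_isGysinHodgeCompatible_complexOrientation_holds
  -- a generic point `δ` of the diagonal, and `[Δ]` as an `n`-cycle
  haveI := GysinFormalism.isClosedImmersion_diagonal_left hX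
  haveI := irreducibleSpace_of_isSmoothProjective' hX
  set Δ := (lift (𝟙 X) (𝟙 X)).left with hΔ
  obtain ⟨δ, hδ⟩ : ∃ δ : ↥(X ⊗ X).left, IsGenericPoint δ (Set.range Δ.base) := by
    refine ⟨Δ.base (genericPoint X.left), ?_⟩
    have h := (genericPoint_spec X.left).image Δ.base.hom.continuous
    rwa [Set.image_univ, Δ.isClosedEmbedding.isClosed_range.closure_eq] at h
  have hn : primeCycle δ ∈ cyclesOfDim (X ⊗ X).left n :=
    primeCycle_mem_cyclesOfDim (height_eq_of_isGenericPoint_diagonal' hX hδ)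
  -- Bloch–Srinivas: `m[Δ] ∼ Z₀ + Z'`
  obtain ⟨m, hm, T, hT, hcod, Z', hZ', hZ'T, Z₀, hZ₀, W₀, W'₀, -, -, hW₀, hsupp, hrat⟩ :=
    ParanjapeLaterveer_generalisedDecompositionOfTheDiagonal.zero
      ParanjapeLaterveer_generalisedDecompositionOfTheDiagonal_holds hX h0 δ hδ
  refine ⟨T, hT, hcod, fun k hk α ↦ ?_⟩
  have hrat' : IsRationallyEquivalent
      ((m • ⟨primeCycle δ, hn⟩ : ↥(cyclesOfDim (X ⊗ X).left n)) : AlgebraicCycle (X ⊗ X).left ℤ)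
      (((⟨Z₀, hZ₀⟩ : ↥(cyclesOfDim (X ⊗ X).left n)) + ⟨Z', hZ'⟩ : ↥(cyclesOfDim (X ⊗ X).left n)) :
        AlgebraicCycle (X ⊗ X).left ℤ) n := hrat
  -- Lemma 9.18 and `[Δ]^* = Id`: `m • α = [Z₀]^*α + [Z']^*α`
  have hact := G.corrAct_congr hX hX k hrat'
  rw [map_nsmul, map_add, G.corrAct_primeCycle_diagonal hX k δ hδ hn] at hact
  have hmα : (m : ℂ) • α = G.corrAct hX hX k ⟨Z₀, hZ₀⟩ α + G.corrAct hX hX k ⟨Z', hZ'⟩ α := by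
    have h := LinearMap.congr_fun hact α
    simp only [LinearMap.smul_apply, LinearMap.id_apply, LinearMap.add_apply] at h
    rw [← h, Nat.cast_smul_eq_nsmul ℂ m α]
  -- `[Z₀]^*α = 0`: every prime cycle of `Z₀` has `pr₂` a closed point, and `k > 0`
  have hZ₀α : G.corrAct hX hX k ⟨Z₀, hZ₀⟩ α = 0 := by
    refine (Submodule.mem_bot ℂ).1 (G.corrAct_mem_of_primeCycle hX hX k ⊥ ⟨Z₀, hZ₀⟩ α
      fun z hz0 hz ↦ (Submodule.mem_bot ℂ).2 ?_)
    exact genericDivisibilityBounded_corrAct_primeCycle_eq_zero_of_height_snd_le G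
      Resolution.Hironaka1964_projective_holds hX z hz (hZ₀ z hz0) (d₀ := 0)
      (hW₀ _ (hsupp z hz0).2) (by omega) α
  -- `[Z']^*α` vanishes off `T`
  have hZ'α : complexBetti.restrictCompl X T k (G.corrAct hX hX k ⟨Z', hZ'⟩ α) = 0 :=
    G.restrictCompl_corrAct hX hX k hT hZ'T α
  have hmres : (m : ℂ) • complexBetti.restrictCompl X T k α = 0 := by
    rw [← map_smul, hmα, hZ₀α, zero_add, hZ'α]
  have hm0 : (m : ℂ) ≠ 0 := by exact_mod_cast hm.ne'
  exact (smul_eq_zero.1 hmres).resolve_left hm0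

/-- **Bloch–Srinivas, coniveau form**: on a smooth projective complex variety with `CH₀ ⊗ ℚ` of rank
`≤ 1`, every class of positive degree has coniveau `≥ 1`: `supportedClasses X k 1 = ⊤` for `k ≥ 1`
(Colliot-Thélène–Voisin 2012 Prop. 3.3 (i) with `ℂ`-coefficients: `H^k(X) → H^k(ℂ(X))` is zero).
[cite: BlochSrinivas1983, Thm. 1 and its proof] [cite: ColliotTheleneVoisin2012, Prop. 3.3 (i)] -/
theorem genericDivisibilityBounded_supportedClasses_one_eq_top_of_chowRankLEOneUpTo_zero
    {n : ℕ} {X : SchemeOver ℂ} (hX : IsSmoothProjective n X) (h0 : ChowRankLEOneUpTo X 0)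
    {k : ℕ} (hk : 1 ≤ k) : supportedClasses X k 1 = ⊤ := by
  obtain ⟨T, hT, hcod, hres⟩ :=
    genericDivisibilityBounded_exists_closed_forall_restrictCompl_eq_zero_of_chowRankLEOneUpTo_zero hX h0
  exact eq_top_iff.2 fun α _ ↦ mem_supportedClasses_of_restrictCompl_eq_zero hT
    (fun t ht ↦ by exact_mod_cast hcod t ht) (hres k hk α)

/-! ### The integral shadow: every integral class is generically torsion, off one divisor -/

/-- The generic point of an integral scheme has codimension `0`: a closed set all of whose points have
codimension `≥ 1` is not everything. [cite: Hartshorne1977, II Ex. 2.9] -/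
theorem genericDivisibilityBounded_ne_univ_of_forall_one_le_coheight {X : SchemeOver ℂ}
    [IsIntegral X.left] {T : Set X.left} (hcod : ∀ t ∈ T, (1 : ℕ∞) ≤ Order.coheight t) :
    T ≠ Set.univ := by
  intro hT
  have h1 := hcod (genericPoint X.left) (hT ▸ Set.mem_univ _)
  have hmax : IsMax (genericPoint X.left) := fun y _ ↦
    Scheme.le_iff_specializes.2 (genericPoint_specializes y)
  rw [Order.coheight_eq_zero.2 hmax] at h1
  exact absurd h1 (by norm_num)

/-- **Bloch–Srinivas, integral coefficients.** On a smooth projective complex `n`-fold `X` with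
`CH₀ ⊗ ℚ` of rank `≤ 1` there is ONE proper Zariski-closed `T` such that every integral class
`z ∈ Hᵏ(X(ℂ); ℤ)` of degree `k ≥ 1` is killed by some `N ≥ 1` on `(X ∖ T)(ℂ)`: its complexification
dies there (`…_restrictCompl_eq_zero_…`, change of coefficients commutes with restriction), and an
integral class of `(X ∖ T)(ℂ)` with vanishing complexification is torsion by universal coefficients,
`H_{k-1}((X ∖ T)(ℂ); ℤ)` being finitely generated (Dimca 1992 Ch. 1 Cor. (6.10), PROVED in the tree).
So the integral "generic lattice" `im(Hᵏ(X;ℤ) → Hᵏ(ℂ(X);ℤ))` is torsion on this sector.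
[cite: BlochSrinivas1983, Thm. 1 and its proof] [cite: HatcherAT2002, §3.1 Thm. 3.2]
[cite: Dimca1992, Ch. 1 Cor. (6.10)] -/
theorem genericDivisibilityBounded_exists_closed_forall_nsmul_restrict_eq_zero_of_chowRankLEOneUpTo_zero
    {n : ℕ} {X : SchemeOver ℂ} (hX : IsSmoothProjective n X) (h0 : ChowRankLEOneUpTo X 0) :
    ∃ T : Set X.left, IsClosed T ∧ T ≠ Set.univ ∧
      ∀ k : ℕ, 1 ≤ k → ∀ z : singularCohomology ℤ ℤ (ComplexPoints X) k, ∃ N : ℕ, 1 ≤ N ∧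
        N • singularCohomology.map ℤ ℤ
          (⟨Subtype.val, continuous_subtype_val⟩ : C(complexPointsCompl X T, ComplexPoints X)) k z = 0 := by
  obtain ⟨T, hT, hcod, hres⟩ :=
    genericDivisibilityBounded_exists_closed_forall_restrictCompl_eq_zero_of_chowRankLEOneUpTo_zero hX h0
  haveI : IsIntegral X.left := IsSmoothProjective.isIntegral_holds hX
  refine ⟨T, hT, genericDivisibilityBounded_ne_univ_of_forall_one_le_coheight hcod, fun k hk z ↦ ?_⟩
  haveI : Module.Finite ℤ (singularHomology ℤ ℤ (complexPointsCompl X T) (k - 1)) :=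
    Dimca1992_finite_singularHomology_complexPointsCompl_holds hX T hT (k - 1)
  refine genericDivisibility_exists_nsmul_eq_zero_of_ringChange_eq_zero (k := k - 1) (by omega) _ ?_
  rw [genericDivisibility_ringChange_map]
  exact hres k hk _

/-! ### The crux C2 and the heart of line `finite-level-bootstrap` on this sector -/

/-- **C2 at every smooth projective `2p`-fold with `CH₀ ⊗ ℚ` of rank `≤ 1`** (`p ≥ 1`; rationally
connected, Fano, cubic fourfolds, …), in the crux's own shape — the divisibility hypothesis is not
even used: EVERY middle class has complexification of coniveau `≥ 1` (Bloch–Srinivas). Hodge-free,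
and free of Bloch–Kato / Colliot-Thélène–Voisin. [cite: BlochSrinivas1983, Thm. 1 and its proof]
[cite: ColliotTheleneVoisin2012, Prop. 3.3 (i)] -/
theorem genericDivisibilityBounded_at_of_chowRankLEOneUpTo_zero {p : ℕ} {X : SchemeOver ℂ}
    (hp : 1 ≤ p) (hX : IsSmoothProjective (2 * p) X) (h0 : ChowRankLEOneUpTo X 0) :
    ∀ z : singularCohomology ℤ ℤ (ComplexPoints X) (2 * p),
      (∀ m : ℕ, 1 ≤ m → ∃ Z : Set X.left, IsClosed Z ∧ Z ≠ Set.univ ∧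
        ∃ y : singularCohomology ℤ ℤ (complexPointsCompl X Z) (2 * p),
          m • y = singularCohomology.map ℤ ℤ
            (⟨Subtype.val, continuous_subtype_val⟩ : C(complexPointsCompl X Z, ComplexPoints X))
            (2 * p) z) →
      singularCohomology.ringChange (Int.castRingHom ℂ) (ComplexPoints X) (2 * p) z ∈
        supportedClasses X (2 * p) 1 := by
  intro z _
  rw [genericDivisibilityBounded_supportedClasses_one_eq_top_of_chowRankLEOneUpTo_zero hX h0
    (k := 2 * p) (by omega)]
  exact Submodule.mem_top

/-- **Registered sub-goal `stub_cruxAtOfChowRankLEOneUpToZero` of the crux item (lead c3): C2 on the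
Bloch–Srinivas sector**, as a closed statement — for every `p ≥ 1` and every smooth projective complex
`2p`-fold `X` with `ChowRankLEOneUpTo X 0`, the crux `GenericDivisibilityBounded` holds at `X`.
[cite: BlochSrinivas1983, Thm. 1 and its proof] [cite: ColliotTheleneVoisin2012, Prop. 3.3 (i)] -/
theorem stub_cruxAtOfChowRankLEOneUpToZero : ∀ ⦃p : ℕ⦄ ⦃X : SchemeOver ℂ⦄, 1 ≤ p → IsSmoothProjective (2 * p) X → ChowRankLEOneUpTo X 0 → ∀ z : singularCohomology ℤ ℤ (ComplexPoints X) (2 * p), (∀ m : ℕ, 1 ≤ m → ∃ Z : Set X.left, IsClosed Z ∧ Z ≠ Set.univ ∧ ∃ y : singularCohomology ℤ ℤ (complexPointsCompl X Z) (2 * p), m • y = singularCohomology.map ℤ ℤ (⟨Subtype.val, continuous_subtype_val⟩ : C(complexPointsCompl X Z, ComplexPoints X)) (2 * p) z) → singularCohomology.ringChange (Int.castRingHom ℂ) (ComplexPoints X) (2 * p) z ∈ supportedClasses X (2 * p) 1 :=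
  fun _ _ hp hX h0 ↦ genericDivisibilityBounded_at_of_chowRankLEOneUpTo_zero hp hX h0

/-- **The HEART of line `finite-level-bootstrap` on this sector, at EVERY prime `ℓ` and EVERY level `s`**
(spelled inline as in the registered stub `stub_finiteLevel`: "`D'(ℓ^s, z) ⇒ ∃ w, z - ℓ • w` is
generically torsion"): take `w = 0` — every integral middle class is generically torsion off the one
divisor complement of Bloch–Srinivas. [cite: BlochSrinivas1983, Thm. 1 and its proof]
[cite: Dimca1992, Ch. 1 Cor. (6.10)] -/
theorem genericDivisibilityBounded_levelClean_of_chowRankLEOneUpTo_zero {n : ℕ} {X : SchemeOver ℂ}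
    (hX : IsSmoothProjective n X) (h0 : ChowRankLEOneUpTo X 0) {k : ℕ} (hk : 1 ≤ k) (ℓ s : ℕ) :
    ∀ z : singularCohomology ℤ ℤ (ComplexPoints X) k,
      (∃ Z : Set X.left, IsClosed Z ∧ Z ≠ Set.univ ∧
        ∃ (y : singularCohomology ℤ ℤ (complexPointsCompl X Z) k) (M : ℕ), 1 ≤ M ∧
          M • (singularCohomology.map ℤ ℤ
            (⟨Subtype.val, continuous_subtype_val⟩ : C(complexPointsCompl X Z, ComplexPoints X))
            k z - ℓ ^ s • y) = 0) →
      ∃ w : singularCohomology ℤ ℤ (ComplexPoints X) k,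
        ∃ Z : Set X.left, IsClosed Z ∧ Z ≠ Set.univ ∧ ∃ N : ℕ, 1 ≤ N ∧
          N • singularCohomology.map ℤ ℤ
            (⟨Subtype.val, continuous_subtype_val⟩ : C(complexPointsCompl X Z, ComplexPoints X))
            k (z - ℓ • w) = 0 := by
  obtain ⟨T, hT, hTne, hN⟩ :=
    genericDivisibilityBounded_exists_closed_forall_nsmul_restrict_eq_zero_of_chowRankLEOneUpTo_zero hX h0
  intro z _
  obtain ⟨N, hN1, hNz⟩ := hN k hk z
  exact ⟨0, T, hT, hTne, N, hN1, by rwa [smul_zero, sub_zero]⟩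

/-! ### The same with the hypothesis on the Chow group, and in the `L`-quantified form of Vial 2013 -/

/-- `ChowRankLEOneUpTo X 0` from the rank-`≤ 1` hypothesis on the Chow GROUP `CH₀(X)`
(`Motives.chowRankLEOneUpTo_iff_chowGroup`). [cite: VoisinHodgeII2003, Thm. 10.29] -/
theorem genericDivisibilityBounded_chowRankLEOneUpTo_zero_of_chowGroup {X : SchemeOver ℂ}
    (hCH : ∀ a b : ChowGroup X.left 0, ∃ m n : ℤ, (m ≠ 0 ∨ n ≠ 0) ∧ m • a = n • b) :
    ChowRankLEOneUpTo X 0 :=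
  (chowRankLEOneUpTo_iff_chowGroup X 0).2 fun j hj a b ↦ by
    obtain rfl : j = 0 := Nat.le_zero.1 hj
    exact hCH a b

/-- **C2 at every smooth projective `2p`-fold (`p ≥ 1`) whose Chow group of `0`-cycles has rank `≤ 1`.**
[cite: BlochSrinivas1983, Thm. 1 and its proof] [cite: ColliotTheleneVoisin2012, Prop. 3.3 (i)] -/
theorem genericDivisibilityBounded_at_of_chowGroup_zero {p : ℕ} {X : SchemeOver ℂ}
    (hp : 1 ≤ p) (hX : IsSmoothProjective (2 * p) X)
    (hCH : ∀ a b : ChowGroup X.left 0, ∃ m n : ℤ, (m ≠ 0 ∨ n ≠ 0) ∧ m • a = n • b) :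
    ∀ z : singularCohomology ℤ ℤ (ComplexPoints X) (2 * p),
      (∀ m : ℕ, 1 ≤ m → ∃ Z : Set X.left, IsClosed Z ∧ Z ≠ Set.univ ∧
        ∃ y : singularCohomology ℤ ℤ (complexPointsCompl X Z) (2 * p),
          m • y = singularCohomology.map ℤ ℤ
            (⟨Subtype.val, continuous_subtype_val⟩ : C(complexPointsCompl X Z, ComplexPoints X))
            (2 * p) z) →
      singularCohomology.ringChange (Int.castRingHom ℂ) (ComplexPoints X) (2 * p) z ∈
        supportedClasses X (2 * p) 1 :=
  genericDivisibilityBounded_at_of_chowRankLEOneUpTo_zero hp hX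
    (genericDivisibilityBounded_chowRankLEOneUpTo_zero_of_chowGroup hCH)

/-- **C2 on the small-Chow sector in the form of Vial 2013, Thm. 7.1 (i)** (the hypothesis of the
tree's `Vial2013_hodgeConjectureFor_of_chowGroups_rank_le_one` and of the C1 companion
`hodgeClassesGenericallyDivisible_of_chowGroups_rank_le_one_of_facts`: rank `≤ 1` of `CH_i(X_L)`,
`i ≤ (2p − 4)/2`, over every algebraically closed `L ⊇ ℂ`; only `i = 0`, `L = ℂ` is used). Unlike the
C1 statement on this sector, no named fact is assumed. [cite: Vial2013, Thm 7.1 (i)]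
[cite: BlochSrinivas1983, Thm. 1 and its proof] -/
theorem genericDivisibilityBounded_at_of_chowGroups_rank_le_one {p : ℕ} {X : SchemeOver ℂ}
    (hp : 1 ≤ p) (hX : IsSmoothProjective (2 * p) X)
    (hCH : ∀ (L : Type) [Field L] [IsAlgClosed L] [Algebra ℂ L] (i : ℕ), i ≤ (2 * p - 4) / 2 →
      ∀ a b : ChowGroup ((baseChange ℂ L).obj X).left i,
        ∃ m n : ℤ, (m ≠ 0 ∨ n ≠ 0) ∧ m • a = n • b) :
    ∀ z : singularCohomology ℤ ℤ (ComplexPoints X) (2 * p),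
      (∀ m : ℕ, 1 ≤ m → ∃ Z : Set X.left, IsClosed Z ∧ Z ≠ Set.univ ∧
        ∃ y : singularCohomology ℤ ℤ (complexPointsCompl X Z) (2 * p),
          m • y = singularCohomology.map ℤ ℤ
            (⟨Subtype.val, continuous_subtype_val⟩ : C(complexPointsCompl X Z, ComplexPoints X))
            (2 * p) z) →
      singularCohomology.ringChange (Int.castRingHom ℂ) (ComplexPoints X) (2 * p) z ∈
        supportedClasses X (2 * p) 1 :=
  genericDivisibilityBounded_at_of_chowRankLEOneUpTo_zero hp hX
    ((chowRankLEOneUpTo_of_chowGroups_rank_le_one hX hCH).mono (Nat.zero_le _))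

end Summit.HodgeConjecture.HodgeConjecture.Theorems

end
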